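import Summits.ValiantsHypothesis.ValiantsHypothesis.Theorems.BarrierLeverChowThinBlockCoefficients

/-!
# Route BarrierLever — thin-row Chow witnesses (item 20195 `ChowHitsThinRowPartitionMinors`), part 3/3:
# the `s = 1` layer for AFFINELY INDEPENDENT column families, by an explicit product of affine forms

Helper file (`--supports stmt-ValiantsHypothesis-20195`; cell valiant-natproofs, rung V4, 𝒟-side of
door (c); seat val-np-p7 gen 3).  Closes NO item.

**Theorem (`chow_hit_thin1_of_affineIndependent`).**  For a layout `u, w : Fin r → Finset (Fin h)`
with `u` injective, all rows of size `≤ 1` (the `s = 1` layer of item 20195) and the homogenised column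
indicators `(1, 1_{w j}) ∈ ℂ^{h+1}` linearly independent (the points `1_{w j}` AFFINELY INDEPENDENT),
some product of `h + h` affine forms has nonzero partition minor `det [coeff_{x^{u i} y^{w j}} ∏ ℓ]`
(the matrix of items 20172 / 20195 verbatim), at EVERY height `h`.
**Witness.**  Take `r` columns `S ∋ 0` of `Z = [𝟙 | 1_{w j}(c)]` with `det Z[·, S] ≠ 0` (part 1) and a
bijection rows → `S` sending the `∅`-row (if any) to the column `0`; a singleton row `{a}` sent to
`c + 1` gets the block `(1 + y_c - x_a)(1 + x_a)` (coefficients `1, 1, 0, 1` at `1, y_c, x_a, x_a y_c`),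
a singleton row sent to `0` puts `+ x_a` into the second form of the block of `y_0`, all other `y_c`
get `(1 + y_c) · 1`.  The blocks use disjoint variables, so the matrix entry `(i, j)` is the product of
block coefficients (`coeff_prod_blocks`) `= Z[j, S(i)]` (`coeff_blockWitness_eq`): minor `= det Z[·,S]`.
**Reach.**  Product-state witnesses see an `s = 1` layout only through the affine matroid of
`{1_{w j}}`: affinely DEPENDENT column families (all of `2^T` — the TNS-killer —, a square
`∅,{1},{2},{1,2}`, …) are exactly where the generic product of `2h` mixed forms is needed.

WHAT THIS IS NOT: not the `s = 1` layer in general (affinely dependent columns stay open here);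
nothing on items 20195 / 20172 / 19717 themselves, on crux stmt-ValiantsHypothesis-14610, or on
`VP ≠ VNP`.
-/

set_option linter.dupNamespace false

namespace Summit.ValiantsHypothesis.ValiantsHypothesis.Theorems.BarrierLever.ChowThinAffine

open Finset MvPolynomial
open Summit.ValiantsHypothesis.ValiantsHypothesis.Theorems.BarrierLever.ProductStateSums
  (castAdd_ne_natAdd partitionExpo_apply_castAdd partitionExpo_apply_natAdd)
open Summit.ValiantsHypothesis.ValiantsHypothesis.Theorems.BarrierLever.ChowFactor
  (coeff_mul_of_disjoint_vars)

/-! ## 4. The partition coefficients of a product of blocks -/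

section Product

variable {h : ℕ}

/-- **Coefficients of a product of blocks on pairwise disjoint variable sets.**  For blocks indexed by
`c ∈ S` with x-sets `B c ∪ Z c` pairwise disjoint, the partition coefficient at `(u, w)` with
`u ⊆ ⋃_{c ∈ S} (B c ∪ Z c)` and `w ⊆ S` is the product of the block coefficients at
`(u ∩ (B c ∪ Z c), w ∩ {c})`. -/
theorem coeff_prod_blocks (B Z : Fin h → Finset (Fin h))
    (hdisj : ∀ c c', c ≠ c' → Disjoint (B c ∪ Z c) (B c' ∪ Z c')) (S : Finset (Fin h)) :
    ∀ u w : Finset (Fin h), u ⊆ S.biUnion (fun c => B c ∪ Z c) → w ⊆ S →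
      coeff (∑ a' ∈ u, Finsupp.single (Fin.castAdd h a') 1 + ∑ c' ∈ w, Finsupp.single (Fin.natAdd h c') 1)
          (∏ c ∈ S, ((C 1 + X (Fin.natAdd h c) - ∑ b ∈ B c, X (Fin.castAdd h b)) *
            (C 1 + ∑ b ∈ B c, X (Fin.castAdd h b) + ∑ a ∈ Z c, X (Fin.castAdd h a)) :
            MvPolynomial (Fin (h + h)) ℂ)) =
        ∏ c ∈ S, coeff (∑ a' ∈ u.filter (fun a' => a' ∈ B c ∪ Z c), Finsupp.single (Fin.castAdd h a') 1 +
            ∑ c' ∈ w.filter (fun c' => c' ∈ ({c} : Finset (Fin h))), Finsupp.single (Fin.natAdd h c') 1)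
          ((C 1 + X (Fin.natAdd h c) - ∑ b ∈ B c, X (Fin.castAdd h b)) *
            (C 1 + ∑ b ∈ B c, X (Fin.castAdd h b) + ∑ a ∈ Z c, X (Fin.castAdd h a)) :
            MvPolynomial (Fin (h + h)) ℂ) := by
  classical
  induction S using Finset.induction_on with
  | empty =>
    intro u w hu hw
    rw [Finset.biUnion_empty] at hu
    rw [Finset.subset_empty.mp hu, Finset.subset_empty.mp hw, Finset.prod_empty, Finset.prod_empty,
      Finset.sum_empty, Finset.sum_empty, add_zero, coeff_one, if_pos rfl]
  | insert c S hcS ih =>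
    intro u w hu hw
    rw [Finset.prod_insert hcS, Finset.prod_insert hcS]
    have hq : Disjoint
        (∏ c' ∈ S, ((C 1 + X (Fin.natAdd h c') - ∑ b ∈ B c', X (Fin.castAdd h b)) *
            (C 1 + ∑ b ∈ B c', X (Fin.castAdd h b) + ∑ a ∈ Z c', X (Fin.castAdd h a)) :
            MvPolynomial (Fin (h + h)) ℂ)).vars
        ((B c ∪ Z c).image (Fin.castAdd h) ∪ ({c} : Finset (Fin h)).image (Fin.natAdd h)) := by
      rw [Finset.disjoint_left]
      intro v hv hvc
      have hv' := vars_prod _ hv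
      rw [Finset.mem_biUnion] at hv'
      obtain ⟨c', hc'S, hvc'⟩ := hv'
      have hne : c ≠ c' := fun e => hcS (e ▸ hc'S)
      have hT' := vars_block c' (B c') (Z c') hvc'
      rw [Finset.mem_union, Finset.mem_image, Finset.mem_image] at hT' hvc
      rcases hT' with ⟨a', ha', rfl⟩ | ⟨d', hd', rfl⟩
      · rcases hvc with ⟨a, ha, e⟩ | ⟨d, _, e⟩
        · have haa : a = a' := Fin.castAdd_injective _ _ e
          subst haa
          exact Finset.disjoint_left.mp (hdisj c c' hne) ha ha'
        · exact castAdd_ne_natAdd a' d e.symm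
      · rw [Finset.mem_singleton] at hd'
        subst hd'
        rcases hvc with ⟨a, _, e⟩ | ⟨d, hd, e⟩
        · exact castAdd_ne_natAdd a d' e
        · rw [Finset.mem_singleton] at hd
          exact hne (hd ▸ (Fin.natAdd_injective _ _ e))
    rw [coeff_partitionExpo_mul_block _ _ (B c ∪ Z c) {c} (vars_block c (B c) (Z c)) hq u w]
    congr 1
    have hu' : u.filter (fun a' => a' ∉ B c ∪ Z c) ⊆ S.biUnion (fun c => B c ∪ Z c) := by
      intro a ha
      rw [Finset.mem_filter] at ha
      have := hu ha.1
      rw [Finset.biUnion_insert, Finset.mem_union] at this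
      exact this.resolve_left ha.2
    have hw' : w.filter (fun c' => c' ∉ ({c} : Finset (Fin h))) ⊆ S := by
      intro d hd
      rw [Finset.mem_filter, Finset.mem_singleton] at hd
      have := hw hd.1
      rw [Finset.mem_insert] at this
      exact this.resolve_left hd.2
    rw [ih _ _ hu' hw']
    refine Finset.prod_congr rfl fun c' hc' => ?_
    have hne : c ≠ c' := fun e => hcS (e ▸ hc')
    have e1 : (u.filter (fun a' => a' ∉ B c ∪ Z c)).filter (fun a' => a' ∈ B c' ∪ Z c') =
        u.filter (fun a' => a' ∈ B c' ∪ Z c') := by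
      ext a
      simp only [Finset.mem_filter]
      constructor
      · exact fun ⟨⟨ha, _⟩, ha'⟩ => ⟨ha, ha'⟩
      · exact fun ⟨ha, ha'⟩ =>
          ⟨⟨ha, fun hac => Finset.disjoint_left.mp (hdisj c c' hne) hac ha'⟩, ha'⟩
    have e2 : (w.filter (fun c'' => c'' ∉ ({c} : Finset (Fin h)))).filter
        (fun c'' => c'' ∈ ({c'} : Finset (Fin h))) =
        w.filter (fun c'' => c'' ∈ ({c'} : Finset (Fin h))) := by
      ext d
      simp only [Finset.mem_filter, Finset.mem_singleton]
      constructor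
      · exact fun ⟨⟨hd, _⟩, hd'⟩ => ⟨hd, hd'⟩
      · exact fun ⟨hd, hd'⟩ => ⟨⟨hd, fun hdc => hne (hdc ▸ hd')⟩, hd'⟩
    rw [e1, e2]

/-- **The entry of the partition matrix of the block witness.**  With an injective column assignment
`g : rows → Fin (h+1)` sending `∅`-rows to `0`, and blocks whose x-sets `B c` (indicator rows
assigned to the column `c+1`) and `Z c` (rows assigned to the column `0`) are compatible with `g`,
the partition coefficient at `(u i, w j)` is `Z[j, g i]`, `Z = [𝟙 | 1_{w j}(c)]`. -/
theorem coeff_blockWitness_eq {r : ℕ} (u w : Fin r → Finset (Fin h)) (hcard : ∀ i, (u i).card ≤ 1)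
    (g : Fin r → Fin (h + 1)) (hg0 : ∀ i, u i = ∅ → g i = 0)
    (B Z : Fin h → Finset (Fin h))
    (hdisj : ∀ c c', c ≠ c' → Disjoint (B c ∪ Z c) (B c' ∪ Z c'))
    (hBZ : ∀ c, Disjoint (B c) (Z c))
    (hrow0 : ∀ i a, u i = {a} → g i = 0 → ∃ c, a ∈ Z c)
    (hrowS : ∀ i a (c : Fin h), u i = {a} → g i = c.succ → a ∈ B c) (i j : Fin r) :
    coeff (∑ a' ∈ u i, Finsupp.single (Fin.castAdd h a') 1 + ∑ c' ∈ w j, Finsupp.single (Fin.natAdd h c') 1)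
        (∏ c : Fin h, ((C 1 + X (Fin.natAdd h c) - ∑ b ∈ B c, X (Fin.castAdd h b)) *
          (C 1 + ∑ b ∈ B c, X (Fin.castAdd h b) + ∑ a ∈ Z c, X (Fin.castAdd h a)) :
          MvPolynomial (Fin (h + h)) ℂ)) =
      (Fin.cons (1 : ℂ) (fun c : Fin h => if c ∈ w j then (1 : ℂ) else 0) : Fin (h + 1) → ℂ) (g i) := by
  classical
  have hwf : ∀ c : Fin h, (w j).filter (fun c' => c' ∈ ({c} : Finset (Fin h))) =
      if c ∈ w j then {c} else ∅ := by
    intro c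
    ext d
    by_cases hc : c ∈ w j
    · rw [if_pos hc, Finset.mem_filter, Finset.mem_singleton]
      exact ⟨fun hd => hd.2, fun hd => ⟨hd ▸ hc, hd⟩⟩
    · rw [if_neg hc, Finset.mem_filter, Finset.mem_singleton]
      simp only [Finset.notMem_empty, iff_false, not_and]
      exact fun hd hdc => hc (hdc ▸ hd)
  have hfree : ∀ c : Fin h, coeff (∑ a' ∈ (∅ : Finset (Fin h)), Finsupp.single (Fin.castAdd h a') 1 +
      ∑ c' ∈ (w j).filter (fun c' => c' ∈ ({c} : Finset (Fin h))), Finsupp.single (Fin.natAdd h c') 1)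
      ((C 1 + X (Fin.natAdd h c) - ∑ b ∈ B c, X (Fin.castAdd h b)) *
        (C 1 + ∑ b ∈ B c, X (Fin.castAdd h b) + ∑ a ∈ Z c, X (Fin.castAdd h a)) :
        MvPolynomial (Fin (h + h)) ℂ) = 1 := by
    intro c
    rw [hwf c]
    by_cases hc : c ∈ w j
    · rw [if_pos hc, coeff_block_0y]
    · rw [if_neg hc, coeff_block_00]
  rcases Nat.le_one_iff_eq_zero_or_eq_one.mp (hcard i) with h0 | h1
  · -- the `∅`-row
    have hui : u i = ∅ := Finset.card_eq_zero.mp h0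
    rw [hg0 i hui, Fin.cons_zero]
    rw [coeff_prod_blocks B Z hdisj Finset.univ (u i) (w j) (by rw [hui]; exact Finset.empty_subset _)
      (Finset.subset_univ _)]
    refine Finset.prod_eq_one fun c _ => ?_
    rw [hui, Finset.filter_empty]
    exact hfree c
  · -- a singleton row `{a}`
    obtain ⟨a, hua⟩ := Finset.card_eq_one.mp h1
    have hblock : ∃ c₁, a ∈ B c₁ ∪ Z c₁ ∧
        ((g i = 0 ∧ a ∈ Z c₁ ∧ a ∉ B c₁) ∨ (g i = c₁.succ ∧ a ∈ B c₁ ∧ a ∉ Z c₁)) := by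
      by_cases hgi : g i = 0
      · obtain ⟨c₁, hc₁⟩ := hrow0 i a hua hgi
        exact ⟨c₁, Finset.mem_union_right _ hc₁,
          Or.inl ⟨hgi, hc₁, fun hb => Finset.disjoint_left.mp (hBZ c₁) hb hc₁⟩⟩
      · obtain ⟨c₁, hc₁⟩ := Fin.exists_succ_eq.mpr hgi
        have hb := hrowS i a c₁ hua hc₁.symm
        exact ⟨c₁, Finset.mem_union_left _ hb,
          Or.inr ⟨hc₁.symm, hb, fun hz => Finset.disjoint_left.mp (hBZ c₁) hb hz⟩⟩
    obtain ⟨c₁, hac₁, hcases⟩ := hblock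
    have hsub : u i ⊆ (Finset.univ : Finset (Fin h)).biUnion (fun c => B c ∪ Z c) := by
      rw [hua, Finset.singleton_subset_iff, Finset.mem_biUnion]
      exact ⟨c₁, Finset.mem_univ _, hac₁⟩
    rw [coeff_prod_blocks B Z hdisj Finset.univ (u i) (w j) hsub (Finset.subset_univ _)]
    rw [Finset.prod_eq_single c₁]
    · -- the factor at `c₁`
      have hfilt : (u i).filter (fun a' => a' ∈ B c₁ ∪ Z c₁) = {a} := by
        rw [hua]; ext x; simp only [Finset.mem_filter, Finset.mem_singleton]
        exact ⟨fun hx => hx.1, fun hx => ⟨hx, hx ▸ hac₁⟩⟩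
      rw [hfilt, hwf c₁]
      rcases hcases with ⟨hgi, haZ, haB⟩ | ⟨hgi, haB, haZ⟩
      · rw [hgi, Fin.cons_zero]
        by_cases hc : c₁ ∈ w j
        · rw [if_pos hc, coeff_block_xy, if_neg haB, if_pos haZ, zero_add]
        · rw [if_neg hc, coeff_block_x0, if_pos haZ]
      · rw [hgi, Fin.cons_succ]
        by_cases hc : c₁ ∈ w j
        · rw [if_pos hc, coeff_block_xy, if_pos haB, if_neg haZ, add_zero, if_pos hc]
        · rw [if_neg hc, coeff_block_x0, if_neg haZ, if_neg hc]
    · -- the other factors are `1`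
      intro c _ hc
      have hfilt : (u i).filter (fun a' => a' ∈ B c ∪ Z c) = ∅ := by
        rw [hua]; ext x
        simp only [Finset.mem_filter, Finset.mem_singleton, Finset.notMem_empty, iff_false, not_and]
        intro hx hxc
        subst hx
        exact Finset.disjoint_left.mp (hdisj c c₁ hc) hxc hac₁
      rw [hfilt]
      exact hfree c
    · exact fun hc => absurd (Finset.mem_univ c₁) hc

end Product

/-! ## 5. The theorem -/

section Main

/-- **The `s = 1` layer of thin-row CPM for affinely independent column families** (helper towards
item 20195 `ChowHitsThinRowPartitionMinors`, every height `h`).  If the rows `u i` have size `≤ 1`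
(`u` injective) and the homogenised column indicators `(1, 1_{w j}) ∈ ℂ^{h+1}` are linearly independent
(the points `1_{w j}` are affinely independent), then some product of `h + h` affine forms has a
nonzero partition minor `det [coeff_{x^{u i} y^{w j}} ∏ ℓ]` — the matrix of items 20172 / 20195
verbatim. -/
theorem chow_hit_thin1_of_affineIndependent (h r : ℕ) (u w : Fin r → Finset (Fin h))
    (hu : Function.Injective u) (hcard : ∀ i, (u i).card ≤ 1)
    (haff : LinearIndependent ℂ (fun j : Fin r =>
      (Fin.cons (1 : ℂ) (fun c : Fin h => if c ∈ w j then (1 : ℂ) else 0) : Fin (h + 1) → ℂ))) :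
    ∃ ℓ : Fin (h + h) → MvPolynomial (Fin (h + h)) ℂ, (∀ k, (ℓ k).totalDegree ≤ 1) ∧
      (Matrix.of fun i j : Fin r => MvPolynomial.coeff
        (∑ a ∈ u i, Finsupp.single (Fin.castAdd h a) 1 + ∑ c ∈ w j, Finsupp.single (Fin.natAdd h c) 1)
        (∏ k, ℓ k)).det ≠ 0 := by
  classical
  -- the homogenised indicator matrix `Z = [𝟙 | 1_{w j}(c)]`
  set Zm : Matrix (Fin r) (Fin (h + 1)) ℂ :=
    Matrix.of fun j k => (Fin.cons (1 : ℂ) (fun c : Fin h => if c ∈ w j then (1 : ℂ) else 0) :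
      Fin (h + 1) → ℂ) k with hZm
  have hrow : LinearIndependent ℂ Zm.row := haff
  -- degenerate case `r = 0`
  rcases Nat.eq_zero_or_pos r with hr | hr
  · subst hr
    refine ⟨fun _ => 1, fun _ => by rw [totalDegree_one]; exact Nat.zero_le _, ?_⟩
    rw [Matrix.det_isEmpty]
    exact one_ne_zero
  -- degenerate case `h = 0`: then `r = 1`, all sets are empty and the empty product works
  rcases Nat.eq_zero_or_pos h with hh | hh
  · subst hh
    have hr1 : r ≤ 1 := by
      have := haff.fintype_card_le_finrank
      rw [Fintype.card_fin, Module.finrank_fin_fun] at this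
      simpa using this
    obtain rfl : r = 1 := le_antisymm hr1 hr
    refine ⟨fun _ => 1, fun _ => by rw [totalDegree_one]; exact Nat.zero_le _, ?_⟩
    rw [Matrix.det_unique]
    have hu0 : u default = ∅ := Finset.eq_empty_of_forall_notMem fun x _ => Fin.elim0 x
    have hw0 : w default = ∅ := Finset.eq_empty_of_forall_notMem fun x _ => Fin.elim0 x
    rw [Matrix.of_apply, hu0, hw0, Finset.sum_empty, Finset.sum_empty,
      show ((0 : Fin (0 + 0) →₀ ℕ) + 0) = 0 from add_zero _, Finset.prod_const_one, coeff_one,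
      if_pos rfl]
    exact one_ne_zero
  -- a nonsingular maximal minor of `Z` through the all-ones column `0`
  obtain ⟨g₁, hg₁, hdet₁⟩ := exists_submatrix_det_ne_zero Zm hrow
  have hcol0 : (fun i => Zm i 0) ≠ 0 := by
    intro h0
    have := congrFun h0 ⟨0, hr⟩
    rw [hZm, Matrix.of_apply, Fin.cons_zero] at this
    exact one_ne_zero this
  obtain ⟨g₂, hg₂, hdet₂, ⟨i₁, hi₁⟩⟩ := exists_submatrix_det_ne_zero_through Zm g₁ hg₁ hdet₁ 0 hcol0
  -- arrange that the `∅`-row (if any; it is unique) is sent to the column `0`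
  obtain ⟨g, hg, hdet, hg0⟩ : ∃ g : Fin r → Fin (h + 1), Function.Injective g ∧
      (Zm.submatrix id g).det ≠ 0 ∧ ∀ i, u i = ∅ → g i = 0 := by
    by_cases hex : ∃ i₀, u i₀ = ∅
    · obtain ⟨i₀, hi₀⟩ := hex
      refine ⟨g₂ ∘ ⇑(Equiv.swap i₀ i₁), hg₂.comp (Equiv.injective _), ?_, ?_⟩
      · have : Zm.submatrix id (g₂ ∘ ⇑(Equiv.swap i₀ i₁)) =
            (Zm.submatrix id g₂).submatrix id ⇑(Equiv.swap i₀ i₁) := by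
          rw [Matrix.submatrix_submatrix]; rfl
        rw [this, Matrix.det_permute']
        refine mul_ne_zero ?_ hdet₂
        rcases Int.units_eq_one_or (Equiv.Perm.sign (Equiv.swap i₀ i₁)) with e | e <;> simp [e]
      · intro i hi
        have : i = i₀ := hu (hi.trans hi₀.symm)
        subst this
        simp [hi₁]
    · exact ⟨g₂, hg₂, hdet₂, fun i hi => absurd ⟨i, hi⟩ hex⟩
  -- the blocks
  set c₀ : Fin h := ⟨0, hh⟩ with hc₀
  set Bf : Fin h → Finset (Fin h) := fun c => (Finset.univ.filter fun i => g i = c.succ).biUnion u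
    with hBf
  set Zf : Fin h → Finset (Fin h) := fun c =>
    if c = c₀ then (Finset.univ.filter fun i => g i = 0).biUnion u else ∅ with hZf
  have hrowS : ∀ i a (c : Fin h), u i = {a} → g i = c.succ → a ∈ Bf c := by
    intro i a c hua hgi
    rw [hBf]
    simp only [Finset.mem_biUnion, Finset.mem_filter, Finset.mem_univ, true_and]
    exact ⟨i, hgi, by rw [hua]; exact Finset.mem_singleton_self a⟩
  have hrow0 : ∀ i a, u i = {a} → g i = 0 → ∃ c, a ∈ Zf c := by
    intro i a hua hgi
    refine ⟨c₀, ?_⟩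
    rw [hZf]
    simp only [if_true, Finset.mem_biUnion, Finset.mem_filter, Finset.mem_univ, true_and]
    exact ⟨i, hgi, by rw [hua]; exact Finset.mem_singleton_self a⟩
  have hmemB : ∀ c x, x ∈ Bf c → ∃ i, g i = c.succ ∧ x ∈ u i := by
    intro c x hx
    rw [hBf] at hx
    simp only [Finset.mem_biUnion, Finset.mem_filter, Finset.mem_univ, true_and] at hx
    exact hx
  have hmemZ : ∀ c x, x ∈ Zf c → c = c₀ ∧ ∃ i, g i = 0 ∧ x ∈ u i := by
    intro c x hx
    rw [hZf] at hx
    by_cases hc : c = c₀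
    · simp only [hc, if_true, Finset.mem_biUnion, Finset.mem_filter, Finset.mem_univ, true_and] at hx
      exact ⟨hc, hx⟩
    · simp only [hc, if_false] at hx
      exact absurd hx (Finset.notMem_empty x)
  have hBZ : ∀ c, Disjoint (Bf c) (Zf c) := by
    intro c
    rw [Finset.disjoint_left]
    intro x hxB hxZ
    obtain ⟨i, hgi, hxi⟩ := hmemB c x hxB
    obtain ⟨-, i', hgi', hxi'⟩ := hmemZ c x hxZ
    have := row_eq_of_mem hu hcard hxi hxi'
    subst this
    rw [hgi] at hgi'
    exact Fin.succ_ne_zero c hgi'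
  have hdisj : ∀ c c', c ≠ c' → Disjoint (Bf c ∪ Zf c) (Bf c' ∪ Zf c') := by
    intro c c' hne
    rw [Finset.disjoint_left]
    intro x hx hx'
    rw [Finset.mem_union] at hx hx'
    rcases hx with hx | hx <;> rcases hx' with hx' | hx'
    · obtain ⟨i, hgi, hxi⟩ := hmemB c x hx
      obtain ⟨i', hgi', hxi'⟩ := hmemB c' x hx'
      have := row_eq_of_mem hu hcard hxi hxi'
      subst this
      rw [hgi] at hgi'
      exact hne (Fin.succ_injective _ hgi')
    · obtain ⟨i, hgi, hxi⟩ := hmemB c x hx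
      obtain ⟨-, i', hgi', hxi'⟩ := hmemZ c' x hx'
      have := row_eq_of_mem hu hcard hxi hxi'
      subst this
      rw [hgi] at hgi'
      exact Fin.succ_ne_zero c hgi'
    · obtain ⟨-, i, hgi, hxi⟩ := hmemZ c x hx
      obtain ⟨i', hgi', hxi'⟩ := hmemB c' x hx'
      have := row_eq_of_mem hu hcard hxi hxi'
      subst this
      rw [hgi'] at hgi
      exact Fin.succ_ne_zero c' hgi
    · obtain ⟨hc, -⟩ := hmemZ c x hx
      obtain ⟨hc', -⟩ := hmemZ c' x hx'
      exact hne (hc.trans hc'.symm)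
  -- the witness: `ℓ (castAdd c) = 1 + y_c - Σ_{B c} x`, `ℓ (natAdd c) = 1 + Σ_{B c} x + Σ_{Z c} x`
  refine ⟨Fin.append
      (fun c => (C 1 + X (Fin.natAdd h c) - ∑ b ∈ Bf c, X (Fin.castAdd h b) :
        MvPolynomial (Fin (h + h)) ℂ))
      (fun c => (C 1 + ∑ b ∈ Bf c, X (Fin.castAdd h b) + ∑ a ∈ Zf c, X (Fin.castAdd h a) :
        MvPolynomial (Fin (h + h)) ℂ)), ?_, ?_⟩
  · intro k
    induction k using Fin.addCases with
    | left c => rw [Fin.append_left]; exact totalDegree_blockForm₁ c (Bf c)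
    | right c => rw [Fin.append_right]; exact totalDegree_blockForm₂ (Bf c) (Zf c)
  · have hprod : (∏ k, Fin.append
        (fun c => (C 1 + X (Fin.natAdd h c) - ∑ b ∈ Bf c, X (Fin.castAdd h b) :
          MvPolynomial (Fin (h + h)) ℂ))
        (fun c => (C 1 + ∑ b ∈ Bf c, X (Fin.castAdd h b) + ∑ a ∈ Zf c, X (Fin.castAdd h a) :
          MvPolynomial (Fin (h + h)) ℂ)) k) =
        ∏ c : Fin h, ((C 1 + X (Fin.natAdd h c) - ∑ b ∈ Bf c, X (Fin.castAdd h b)) *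
          (C 1 + ∑ b ∈ Bf c, X (Fin.castAdd h b) + ∑ a ∈ Zf c, X (Fin.castAdd h a)) :
          MvPolynomial (Fin (h + h)) ℂ) := by
      rw [Fin.prod_univ_add]
      simp only [Fin.append_left, Fin.append_right]
      rw [← Finset.prod_mul_distrib]
    rw [hprod]
    have hentry : (Matrix.of fun i j : Fin r => MvPolynomial.coeff
        (∑ a ∈ u i, Finsupp.single (Fin.castAdd h a) 1 + ∑ c ∈ w j, Finsupp.single (Fin.natAdd h c) 1)
        (∏ c : Fin h, ((C 1 + X (Fin.natAdd h c) - ∑ b ∈ Bf c, X (Fin.castAdd h b)) *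
          (C 1 + ∑ b ∈ Bf c, X (Fin.castAdd h b) + ∑ a ∈ Zf c, X (Fin.castAdd h a)) :
          MvPolynomial (Fin (h + h)) ℂ))) = (Zm.submatrix id g).transpose := by
      ext i j
      rw [Matrix.of_apply, Matrix.transpose_apply, Matrix.submatrix_apply, hZm, Matrix.of_apply]
      exact coeff_blockWitness_eq u w hcard g hg0 Bf Zf hdisj hBZ hrow0 hrowS i j
    rw [hentry, Matrix.det_transpose]
    exact hdet

end Main

end Summit.ValiantsHypothesis.ValiantsHypothesis.Theorems.BarrierLever.ChowThinAffine
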